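import Summits.QuantumFields.QCD.Theses.PauliWegnerSea

/-!
# Crux `GluonicCompletion` (stmt-QuantumFields-9152), line `finite-sign-budget-at-the-scheme-volume` — stub `stub_su3CircleWord`

Generation of `SU(3)` by nine circle letters (pure linear algebra): every `A ∈ SU(3)` is the word
`[P₁₂(θ₀) R₁₂(θ₁) P₁₂(θ₂)] · [P₀₁(θ₃) R₀₁(θ₄) P₀₁(θ₅)] · [P₁₂(θ₆) R₁₂(θ₇) P₁₂(θ₈)]` in the four
one-parameter circles `P₁₂(θ) = diag(1, e^{iθ}, e^{-iθ})`, `R₁₂(θ)` = real rotation of the coordinates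
`(1,2)`, `P₀₁(θ) = diag(e^{iθ}, e^{-iθ}, 1)`, `R₀₁(θ)` = real rotation of the coordinates `(0,1)`.

Proof.  STEP A (`SU(2)` Euler angles): for `‖a‖² + ‖b‖² = 1` one has `a = e^{iα} cos β e^{iγ}`,
`b = e^{-iα} sin β e^{iγ}` with `β = arccos ‖a‖`, `α = (arg a - arg b)/2`, `γ = (arg a + arg b)/2`, whence the
embedded `SU(2)` matrices `ι₁₂(a,b) = !![1,0,0; 0,a,-b̄; 0,b,ā]` and `ι₀₁(a,b) = !![a,-b̄,0; b,ā,0; 0,0,1]` are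
letter triples `P R P` in their block.  STEP B (Givens reduction of the first column): with
`r = √(‖A₁₀‖² + ‖A₂₀‖²)`, `G₁ = ι₁₂(A₁₀/r, A₂₀/r)` (`G₁ = 1` if `r = 0`) and `G₂ = ι₀₁(A₀₀, r)` are special
unitary and `B = G₂ᴴ G₁ᴴ A ∈ SU(3)` has `B₀₀ = ‖A₀₀‖² + ‖A₁₀‖² + ‖A₂₀‖² = 1`; a special unitary matrix with
`B₀₀ = 1` is `ι₁₂(B₁₁, B₂₁)` (row/column `0` have norm `1`; the lower block `W` is unitary with `det W = 1`, so
`W₂₂ = W̄₁₁`, `W₁₂ = -W̄₂₁`).  Hence `A = G₁ G₂ B` is a product of three letter triples.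
-/

noncomputable section

namespace Summit.QuantumFields.QCD.Theorems.FiniteSignBudgetAtTheSchemeVolume

open scoped BigOperators
open Complex

/-- On `ℂ`, `star` is complex conjugation (by `rfl`). [folklore] -/
private theorem star_eq_conj (z : ℂ) : star z = (starRingEnd ℂ) z := rfl

/-- `conj (e^{ix}) = e^{-ix}` for real `x`. [folklore] -/
private theorem star_exp_ofReal_mul_I (x : ℝ) : star (cexp (x * I)) = cexp (-(x * I)) := by
  rw [star_eq_conj, ← Complex.exp_conj, map_mul, Complex.conj_ofReal, Complex.conj_I, mul_neg]

/-- `conj (e^{-ix}) = e^{ix}` for real `x`. [folklore] -/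
private theorem star_exp_neg_ofReal_mul_I (x : ℝ) : star (cexp (-(x * I))) = cexp (x * I) := by
  rw [star_eq_conj, ← Complex.exp_conj, map_neg, map_mul, Complex.conj_ofReal, Complex.conj_I,
    mul_neg, neg_neg]

/-- The unit-sphere constraint `‖a‖² + ‖b‖² = 1` in complex form `ā a + b̄ b = 1`. [folklore] -/
private theorem conj_mul_add_conj_mul {a b : ℂ} (h : ‖a‖ ^ 2 + ‖b‖ ^ 2 = 1) :
    (starRingEnd ℂ) a * a + (starRingEnd ℂ) b * b = 1 := by
  rw [Complex.conj_mul', Complex.conj_mul']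
  exact_mod_cast h

/-- **`SU(2)` Euler angles, scalar form.**  If `‖a‖² + ‖b‖² = 1` then `a = e^{iα} cos β e^{iγ}` and
`b = e^{-iα} sin β e^{iγ}` for `β = arccos ‖a‖` (so `cos β = ‖a‖`, `sin β = √(1 - ‖a‖²) = ‖b‖`),
`α = (arg a - arg b)/2`, `γ = (arg a + arg b)/2` (polar decompositions `z = ‖z‖ e^{i arg z}`). [folklore] -/
private theorem euler_scalar {a b : ℂ} (h : ‖a‖ ^ 2 + ‖b‖ ^ 2 = 1) :
    ∃ α β γ : ℝ, a = cexp (α * I) * Real.cos β * cexp (γ * I) ∧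
      b = cexp (-(α * I)) * Real.sin β * cexp (γ * I) := by
  refine ⟨(arg a - arg b) / 2, Real.arccos ‖a‖, (arg a + arg b) / 2, ?_, ?_⟩
  · have ha1 : ‖a‖ ≤ 1 := by nlinarith [norm_nonneg a, norm_nonneg b]
    rw [Real.cos_arccos (by linarith [norm_nonneg a]) ha1]
    have he : cexp (((arg a - arg b) / 2 : ℝ) * I) * cexp (((arg a + arg b) / 2 : ℝ) * I) =
        cexp (arg a * I) := by
      rw [← Complex.exp_add]; congr 1; push_cast; ring
    calc a = ‖a‖ * cexp (arg a * I) := (norm_mul_exp_arg_mul_I a).symm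
      _ = _ := by rw [← he]; ring
  · have hb : Real.sin (Real.arccos ‖a‖) = ‖b‖ := by
      rw [Real.sin_arccos, show 1 - ‖a‖ ^ 2 = ‖b‖ ^ 2 by linarith, Real.sqrt_sq (norm_nonneg b)]
    rw [hb]
    have he : cexp (-((((arg a - arg b) / 2 : ℝ) : ℂ) * I)) * cexp (((arg a + arg b) / 2 : ℝ) * I) =
        cexp (arg b * I) := by
      rw [← Complex.exp_add]; congr 1; push_cast; ring
    calc b = ‖b‖ * cexp (arg b * I) := (norm_mul_exp_arg_mul_I b).symm
      _ = _ := by rw [← he]; ring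

/-- **`SU(2)` Euler angles in the block `{1,2}`.**  For `‖a‖² + ‖b‖² = 1` the embedded `SU(2)` matrix
`ι₁₂(a,b) = !![1,0,0; 0,a,-b̄; 0,b,ā]` is a letter triple `P₁₂(α) R₁₂(β) P₁₂(γ)`: the product is
`!![1,0,0; 0, e^{iα} cos β e^{iγ}, -e^{iα} sin β e^{-iγ}; 0, e^{-iα} sin β e^{iγ}, e^{-iα} cos β e^{-iγ}]`,
matched entrywise by `euler_scalar`. [folklore] -/
private theorem euler₁₂ {a b : ℂ} (h : ‖a‖ ^ 2 + ‖b‖ ^ 2 = 1) :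
    ∃ α β γ : ℝ, !![(1 : ℂ), 0, 0; 0, a, -star b; 0, b, star a] =
      !![1, 0, 0; 0, cexp (α * I), 0; 0, 0, cexp (-(α * I))] *
      !![1, 0, 0; 0, (Real.cos β : ℂ), -(Real.sin β : ℂ); 0, (Real.sin β : ℂ), (Real.cos β : ℂ)] *
      !![1, 0, 0; 0, cexp (γ * I), 0; 0, 0, cexp (-(γ * I))] := by
  obtain ⟨α, β, γ, ha, hb⟩ := euler_scalar h
  refine ⟨α, β, γ, ?_⟩
  have h12 : star b = cexp (α * I) * Real.sin β * cexp (-(γ * I)) := by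
    rw [hb, star_mul', star_mul', star_exp_neg_ofReal_mul_I, star_exp_ofReal_mul_I, star_eq_conj,
      Complex.conj_ofReal]
  have h22 : star a = cexp (-(α * I)) * Real.cos β * cexp (-(γ * I)) := by
    rw [ha, star_mul', star_mul', star_exp_ofReal_mul_I, star_exp_ofReal_mul_I, star_eq_conj,
      Complex.conj_ofReal]
  rw [h12, h22, ha, hb, Matrix.mul_fin_three, Matrix.mul_fin_three]
  ext i j
  fin_cases i <;> fin_cases j <;> simp

/-- **`SU(2)` Euler angles in the block `{0,1}`.**  For `‖a‖² + ‖b‖² = 1` the embedded `SU(2)` matrix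
`ι₀₁(a,b) = !![a,-b̄,0; b,ā,0; 0,0,1]` is a letter triple `P₀₁(α) R₀₁(β) P₀₁(γ)` (same entrywise
computation as `euler₁₂`). [folklore] -/
private theorem euler₀₁ {a b : ℂ} (h : ‖a‖ ^ 2 + ‖b‖ ^ 2 = 1) :
    ∃ α β γ : ℝ, !![a, -star b, 0; b, star a, 0; 0, 0, (1 : ℂ)] =
      !![cexp (α * I), 0, 0; 0, cexp (-(α * I)), 0; 0, 0, 1] *
      !![(Real.cos β : ℂ), -(Real.sin β : ℂ), 0; (Real.sin β : ℂ), (Real.cos β : ℂ), 0; 0, 0, 1] *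
      !![cexp (γ * I), 0, 0; 0, cexp (-(γ * I)), 0; 0, 0, 1] := by
  obtain ⟨α, β, γ, ha, hb⟩ := euler_scalar h
  refine ⟨α, β, γ, ?_⟩
  have h12 : star b = cexp (α * I) * Real.sin β * cexp (-(γ * I)) := by
    rw [hb, star_mul', star_mul', star_exp_neg_ofReal_mul_I, star_exp_ofReal_mul_I, star_eq_conj,
      Complex.conj_ofReal]
  have h22 : star a = cexp (-(α * I)) * Real.cos β * cexp (-(γ * I)) := by
    rw [ha, star_mul', star_mul', star_exp_ofReal_mul_I, star_exp_ofReal_mul_I, star_eq_conj,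
      Complex.conj_ofReal]
  rw [h12, h22, ha, hb, Matrix.mul_fin_three, Matrix.mul_fin_three]
  ext i j
  fin_cases i <;> fin_cases j <;> simp

/-- **Embedded `SU(2)` in the block `{1,2}` is special unitary.**  For `‖a‖² + ‖b‖² = 1`,
`ι₁₂(a,b) = !![1,0,0; 0,a,-b̄; 0,b,ā] ∈ SU(3)` (`ι₁₂ᴴ ι₁₂ = 1` and `det ι₁₂ = ā a + b̄ b = 1`,
entrywise). [folklore] -/
private theorem iota₁₂_mem {a b : ℂ} (h : ‖a‖ ^ 2 + ‖b‖ ^ 2 = 1) :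
    !![(1 : ℂ), 0, 0; 0, a, -star b; 0, b, star a] ∈ Matrix.specialUnitaryGroup (Fin 3) ℂ := by
  have hc := conj_mul_add_conj_mul h
  rw [Matrix.mem_specialUnitaryGroup_iff, Matrix.mem_unitaryGroup_iff']
  constructor
  · ext i j
    fin_cases i <;> fin_cases j <;> simp [Matrix.mul_apply, Fin.sum_univ_three]
    all_goals first | linear_combination hc | ring
  · rw [Matrix.det_fin_three]
    simp
    linear_combination hc

/-- **Embedded `SU(2)` in the block `{0,1}` is special unitary.**  For `‖a‖² + ‖b‖² = 1`,
`ι₀₁(a,b) = !![a,-b̄,0; b,ā,0; 0,0,1] ∈ SU(3)` (`ι₀₁ᴴ ι₀₁ = 1` and `det ι₀₁ = ā a + b̄ b = 1`,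
entrywise). [folklore] -/
private theorem iota₀₁_mem {a b : ℂ} (h : ‖a‖ ^ 2 + ‖b‖ ^ 2 = 1) :
    !![a, -star b, 0; b, star a, 0; 0, 0, (1 : ℂ)] ∈ Matrix.specialUnitaryGroup (Fin 3) ℂ := by
  have hc := conj_mul_add_conj_mul h
  rw [Matrix.mem_specialUnitaryGroup_iff, Matrix.mem_unitaryGroup_iff']
  constructor
  · ext i j
    fin_cases i <;> fin_cases j <;> simp [Matrix.mul_apply, Fin.sum_univ_three]
    all_goals first | linear_combination hc | ring
  · rw [Matrix.det_fin_three]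
    simp
    linear_combination hc

/-- **A special unitary matrix fixing `e₀` is an embedded `SU(2)` in the block `{1,2}`.**  If `B ∈ SU(3)`
has `B₀₀ = 1`, then `‖B₁₁‖² + ‖B₂₁‖² = 1` and `B = !![1,0,0; 0,B₁₁,-B̄₂₁; 0,B₂₁,B̄₁₁]`: column `0` and
row `0` of a unitary matrix have norm `1` (entries `(0,0)` of `Bᴴ B = 1`, `B Bᴴ = 1`), so their other
entries vanish; then `det B = B₁₁ B₂₂ - B₁₂ B₂₁ = 1` (`Matrix.det_fin_three`) and the entries `(1,1)`,
`(1,2)` of `Bᴴ B = 1` give `B₂₂ = B̄₁₁`, `B₁₂ = -B̄₂₁` by linear combination. [folklore] -/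
private theorem block_form {B : Matrix (Fin 3) (Fin 3) ℂ} (hB : B ∈ Matrix.specialUnitaryGroup (Fin 3) ℂ)
    (h00 : B 0 0 = 1) :
    ‖B 1 1‖ ^ 2 + ‖B 2 1‖ ^ 2 = 1 ∧
      B = !![1, 0, 0; 0, B 1 1, -star (B 2 1); 0, B 2 1, star (B 1 1)] := by
  obtain ⟨hU, hdet⟩ := Matrix.mem_specialUnitaryGroup_iff.1 hB
  have h1 : ∀ i j, ∑ k, (starRingEnd ℂ) (B k i) * B k j = if i = j then 1 else 0 := fun i j => by
    have := congr_fun (congr_fun (Matrix.mem_unitaryGroup_iff'.1 hU) i) j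
    simpa [Matrix.mul_apply, Matrix.one_apply] using this
  have h2 : ∀ i j, ∑ k, B i k * (starRingEnd ℂ) (B j k) = if i = j then 1 else 0 := fun i j => by
    have := congr_fun (congr_fun (Matrix.mem_unitaryGroup_iff.1 hU) i) j
    simpa [Matrix.mul_apply, Matrix.one_apply] using this
  -- column `0` has norm `1`
  have hc0 := h1 0 0
  simp only [Fin.sum_univ_three, if_true, h00, norm_one, Complex.ofReal_one, one_pow,
    Complex.conj_mul'] at hc0
  have hc0' : ‖B 1 0‖ ^ 2 + ‖B 2 0‖ ^ 2 = 0 := by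
    exact_mod_cast (by linear_combination hc0 : (‖B 1 0‖ ^ 2 : ℂ) + ‖B 2 0‖ ^ 2 = 0)
  have h10 : B 1 0 = 0 := by
    have : ‖B 1 0‖ ^ 2 = 0 := by nlinarith [sq_nonneg ‖B 1 0‖, sq_nonneg ‖B 2 0‖]
    exact norm_eq_zero.1 (pow_eq_zero_iff two_ne_zero |>.1 this)
  have h20 : B 2 0 = 0 := by
    have : ‖B 2 0‖ ^ 2 = 0 := by nlinarith [sq_nonneg ‖B 1 0‖, sq_nonneg ‖B 2 0‖]
    exact norm_eq_zero.1 (pow_eq_zero_iff two_ne_zero |>.1 this)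
  -- row `0` has norm `1`
  have hr0 := h2 0 0
  simp only [Fin.sum_univ_three, if_true, h00, norm_one, Complex.ofReal_one, one_pow,
    Complex.mul_conj'] at hr0
  have hr0' : ‖B 0 1‖ ^ 2 + ‖B 0 2‖ ^ 2 = 0 := by
    exact_mod_cast (by linear_combination hr0 : (‖B 0 1‖ ^ 2 : ℂ) + ‖B 0 2‖ ^ 2 = 0)
  have h01 : B 0 1 = 0 := by
    have : ‖B 0 1‖ ^ 2 = 0 := by nlinarith [sq_nonneg ‖B 0 1‖, sq_nonneg ‖B 0 2‖]
    exact norm_eq_zero.1 (pow_eq_zero_iff two_ne_zero |>.1 this)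
  have h02 : B 0 2 = 0 := by
    have : ‖B 0 2‖ ^ 2 = 0 := by nlinarith [sq_nonneg ‖B 0 1‖, sq_nonneg ‖B 0 2‖]
    exact norm_eq_zero.1 (pow_eq_zero_iff two_ne_zero |>.1 this)
  -- the lower `2 × 2` block is special unitary
  have e1 : B 1 1 * B 2 2 - B 1 2 * B 2 1 = 1 := by
    rw [Matrix.det_fin_three, h00, h01, h02] at hdet
    linear_combination hdet
  have e3 : (starRingEnd ℂ) (B 1 1) * B 1 1 + (starRingEnd ℂ) (B 2 1) * B 2 1 = 1 := by
    have := h1 1 1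
    simpa [Fin.sum_univ_three, h01] using this
  have e2 : (starRingEnd ℂ) (B 1 1) * B 1 2 + (starRingEnd ℂ) (B 2 1) * B 2 2 = 0 := by
    have := h1 1 2
    simpa [Fin.sum_univ_three, h01, h02] using this
  have ht : B 2 2 = star (B 1 1) := by
    rw [star_eq_conj]
    linear_combination (starRingEnd ℂ) (B 1 1) * e1 + B 2 1 * e2 - B 2 2 * e3
  have hs : B 1 2 = -star (B 2 1) := by
    rw [star_eq_conj]
    linear_combination (-(starRingEnd ℂ) (B 2 1)) * e1 + B 1 1 * e2 - B 1 2 * e3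
  refine ⟨?_, ?_⟩
  · rw [Complex.conj_mul', Complex.conj_mul'] at e3
    exact_mod_cast e3
  · conv_lhs => rw [Matrix.eta_fin_three B]
    rw [h00, h01, h02, h10, h20, ht, hs]

/-- **`stub_su3CircleWord` — generation of `SU(3)` by nine circle letters.**  Every `A ∈ SU(3)` equals
`[P₁₂(θ₀) R₁₂(θ₁) P₁₂(θ₂)] · [P₀₁(θ₃) R₀₁(θ₄) P₀₁(θ₅)] · [P₁₂(θ₆) R₁₂(θ₇) P₁₂(θ₈)]` for some
`θ : Fin 9 → ℝ`, where `P₁₂(θ) = diag(1, e^{iθ}, e^{-iθ})`, `R₁₂(θ)` is the real rotation of the coordinates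
`(1,2)`, `P₀₁(θ) = diag(e^{iθ}, e^{-iθ}, 1)` and `R₀₁(θ)` is the real rotation of the coordinates `(0,1)`.
Proof: Givens reduction of the first column — with `r = √(‖A₁₀‖² + ‖A₂₀‖²)`, the embedded `SU(2)` matrices
`G₁ = ι₁₂(A₁₀/r, A₂₀/r)` (`= 1` if `r = 0`) and `G₂ = ι₀₁(A₀₀, r)` give `B = G₂ᴴ G₁ᴴ A ∈ SU(3)` with
`B₀₀ = 1`, hence `B = ι₁₂(B₁₁, B₂₁)` (`block_form`) and `A = G₁ G₂ B`; each of the three factors is a letter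
triple by the `SU(2)` Euler angles (`euler₁₂`, `euler₀₁`). [folklore] -/
theorem stub_su3CircleWord :
    ∀ A : Matrix (Fin 3) (Fin 3) ℂ, A ∈ Matrix.specialUnitaryGroup (Fin 3) ℂ →
      ∃ θ : Fin 9 → ℝ,
        A = !![1, 0, 0; 0, Complex.exp (θ 0 * Complex.I), 0; 0, 0, Complex.exp (-(θ 0 * Complex.I))] *
            !![1, 0, 0; 0, (Real.cos (θ 1) : ℂ), -(Real.sin (θ 1) : ℂ); 0, (Real.sin (θ 1) : ℂ), (Real.cos (θ 1) : ℂ)] *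
            !![1, 0, 0; 0, Complex.exp (θ 2 * Complex.I), 0; 0, 0, Complex.exp (-(θ 2 * Complex.I))] *
            !![Complex.exp (θ 3 * Complex.I), 0, 0; 0, Complex.exp (-(θ 3 * Complex.I)), 0; 0, 0, 1] *
            !![(Real.cos (θ 4) : ℂ), -(Real.sin (θ 4) : ℂ), 0; (Real.sin (θ 4) : ℂ), (Real.cos (θ 4) : ℂ), 0; 0, 0, 1] *
            !![Complex.exp (θ 5 * Complex.I), 0, 0; 0, Complex.exp (-(θ 5 * Complex.I)), 0; 0, 0, 1] *
            !![1, 0, 0; 0, Complex.exp (θ 6 * Complex.I), 0; 0, 0, Complex.exp (-(θ 6 * Complex.I))] *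
            !![1, 0, 0; 0, (Real.cos (θ 7) : ℂ), -(Real.sin (θ 7) : ℂ); 0, (Real.sin (θ 7) : ℂ), (Real.cos (θ 7) : ℂ)] *
            !![1, 0, 0; 0, Complex.exp (θ 8 * Complex.I), 0; 0, 0, Complex.exp (-(θ 8 * Complex.I))] := by
  intro A hA
  obtain ⟨hU, -⟩ := Matrix.mem_specialUnitaryGroup_iff.1 hA
  -- column `0` of `A` has norm `1`
  have hcolC : (starRingEnd ℂ) (A 0 0) * A 0 0 + (starRingEnd ℂ) (A 1 0) * A 1 0 +
      (starRingEnd ℂ) (A 2 0) * A 2 0 = 1 := by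
    have := congr_fun (congr_fun (Matrix.mem_unitaryGroup_iff'.1 hU) 0) 0
    simpa [Matrix.mul_apply, Fin.sum_univ_three] using this
  have hcolR : ‖A 0 0‖ ^ 2 + ‖A 1 0‖ ^ 2 + ‖A 2 0‖ ^ 2 = 1 := by
    rw [Complex.conj_mul', Complex.conj_mul', Complex.conj_mul'] at hcolC
    exact_mod_cast hcolC
  -- the Givens radius
  set r : ℝ := Real.sqrt (‖A 1 0‖ ^ 2 + ‖A 2 0‖ ^ 2) with hr
  have hr0 : 0 ≤ r := Real.sqrt_nonneg _
  have hr2 : r ^ 2 = ‖A 1 0‖ ^ 2 + ‖A 2 0‖ ^ 2 := Real.sq_sqrt (by positivity)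
  have hr2C : (r : ℂ) ^ 2 = (starRingEnd ℂ) (A 1 0) * A 1 0 + (starRingEnd ℂ) (A 2 0) * A 2 0 := by
    rw [Complex.conj_mul', Complex.conj_mul']
    exact_mod_cast hr2
  -- parameters of the first rotation (block `{1,2}`), uniformly in the degenerate case `r = 0`
  obtain ⟨a₁, b₁, hab, hkey⟩ : ∃ a₁ b₁ : ℂ, ‖a₁‖ ^ 2 + ‖b₁‖ ^ 2 = 1 ∧
      (r : ℂ) * ((starRingEnd ℂ) a₁ * A 1 0 + (starRingEnd ℂ) b₁ * A 2 0) =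
        (starRingEnd ℂ) (A 1 0) * A 1 0 + (starRingEnd ℂ) (A 2 0) * A 2 0 := by
    by_cases h0 : r = 0
    · refine ⟨1, 0, by simp, ?_⟩
      rw [← hr2C, h0]
      simp
    · refine ⟨A 1 0 / r, A 2 0 / r, ?_, ?_⟩
      · rw [norm_div, norm_div, Complex.norm_real, Real.norm_of_nonneg hr0, div_pow, div_pow, ← add_div,
          ← hr2, div_self (pow_ne_zero 2 h0)]
      · have h0' : (r : ℂ) ≠ 0 := Complex.ofReal_ne_zero.2 h0
        rw [map_div₀, map_div₀, Complex.conj_ofReal]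
        field_simp
  -- the second rotation (block `{0,1}`)
  have hzr : ‖A 0 0‖ ^ 2 + ‖(r : ℂ)‖ ^ 2 = 1 := by
    rw [Complex.norm_real, Real.norm_of_nonneg hr0, hr2]
    linarith
  have hG₁ := iota₁₂_mem hab
  have hG₂ := iota₀₁_mem hzr
  obtain ⟨α₁, β₁, γ₁, e₁⟩ := euler₁₂ hab
  obtain ⟨α₂, β₂, γ₂, e₂⟩ := euler₀₁ hzr
  set G₁ : Matrix (Fin 3) (Fin 3) ℂ := !![(1 : ℂ), 0, 0; 0, a₁, -star b₁; 0, b₁, star a₁] with hG₁eq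
  set G₂ : Matrix (Fin 3) (Fin 3) ℂ := !![A 0 0, -star (r : ℂ), 0; (r : ℂ), star (A 0 0), 0; 0, 0, (1 : ℂ)]
    with hG₂eq
  set B : Matrix (Fin 3) (Fin 3) ℂ := star G₂ * star G₁ * A with hBeq
  -- `B ∈ SU(3)`
  have hstar : ∀ G ∈ Matrix.specialUnitaryGroup (Fin 3) ℂ, star G ∈ Matrix.specialUnitaryGroup (Fin 3) ℂ := by
    intro G hG
    obtain ⟨hGu, hGd⟩ := Matrix.mem_specialUnitaryGroup_iff.1 hG
    refine Matrix.mem_specialUnitaryGroup_iff.2 ⟨Unitary.star_mem hGu, ?_⟩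
    rw [Matrix.star_eq_conjTranspose, Matrix.det_conjTranspose, hGd, star_one]
  have hBmem : B ∈ Matrix.specialUnitaryGroup (Fin 3) ℂ := mul_mem (mul_mem (hstar _ hG₂) (hstar _ hG₁)) hA
  -- `B₀₀ = 1`
  have hB00 : B 0 0 = 1 := by
    rw [hBeq, hG₁eq, hG₂eq]
    simp [Matrix.mul_apply, Fin.sum_univ_three, Matrix.star_apply]
    linear_combination hcolC + hkey
  obtain ⟨hpq, hBform⟩ := block_form hBmem hB00
  obtain ⟨α₃, β₃, γ₃, e₃⟩ := euler₁₂ hpq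
  -- `A = G₁ G₂ B`
  have hAeq : A = G₁ * G₂ * B := by
    have h1 : G₁ * star G₁ = 1 := Matrix.mem_unitaryGroup_iff.1 (Matrix.mem_specialUnitaryGroup_iff.1 hG₁).1
    have h2 : G₂ * star G₂ = 1 := Matrix.mem_unitaryGroup_iff.1 (Matrix.mem_specialUnitaryGroup_iff.1 hG₂).1
    rw [hBeq]
    symm
    calc G₁ * G₂ * (star G₂ * star G₁ * A) = G₁ * (G₂ * star G₂) * star G₁ * A := by
          simp only [Matrix.mul_assoc]
      _ = A := by rw [h2, Matrix.mul_one, h1, Matrix.one_mul]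
  -- assemble the word
  refine ⟨![α₁, β₁, γ₁, α₂, β₂, γ₂, α₃, β₃, γ₃], ?_⟩
  simp only [Matrix.cons_val]
  rw [hAeq, hBform, e₃, e₁, e₂]
  simp only [Matrix.mul_assoc]

end Summit.QuantumFields.QCD.Theorems.FiniteSignBudgetAtTheSchemeVolume

end
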